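import Summits.QuantumAdvantage.QuantumAdvantage.Theorems.CubicForrelationNearExactIsExactTwentyTypeO
import Summits.QuantumAdvantage.QuantumAdvantage.Theorems.CubicForrelationNearExactIsExactTwentyLevelEight
import Summits.QuantumAdvantage.QuantumAdvantage.Theorems.CubicForrelationNearExactIsExactFourteenBoundary

/-!
# Crux `CubicForrelation.NearExactIsExact` (stmt-QuantumAdvantage-14043) — n = 20: the boundary value `127/128` is NOT attained;
  `Φ ≥ 127/128 ⇒ Φ = 1` for cubic pairs on 20 bits, so `θ₂₀ ∈ [15/16, 127/128)`

Certificate seat `b2b-cforr-cert` (gen 6).  HONEST FRAMING: a DECIDABLE VERDICT about the finite slice `n = 20` of the crux, obtained by a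
TWO-SIDED (partner-using) argument above the uniform one-sided rate — NOT summit progress (the crux needs one `θ < 1` for all `n`).

The tree had `θ₂₀ ∈ [15/16, 127/128]` (`theta_twenty_bounds`, certificate seat gen 4: the rate `θ_n ≤ 1 − 2^{−⌊n/3⌋−1}` at `n = 20`).
ASSEMBLY (`tb20_isolation_twenty_ge`): write `W_g = 128u` (Ax); on 20 bits the level-7 parity is constant (tower, degree `0`).
* type O (all `u` odd): `Φ < 127/128` (`tt20_typeO_lt`: the residual is `±1` everywhere and quadratic of rank `≤ 2` by the general 3- and 4-flat
  sums; few large frequencies vs the pairing `2²⁶`);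
* `W_g ∈ 256ℤ` (level `≥ 8`): `Φ = 1` (`tl20_levelEight_ge`: 18-flat + engine `fl1_flat_l1`, or the landed tower / bent endgame).
Hence `isolation_twenty_closed` (at the literal type `Fin 20`), `theta_twenty_lt`, `theta_twenty_halfopen`: `15/16 ≤ θ₂₀ < 127/128`.

References: as in the imported files (Ax/McEliece, MacWilliams–Sloane Ch. 13–15, Hou 1998, O'Donnell 2014 §3.3, Aaronson–Ambainis 2018 §1.1.1).
Everything below is proved from Mathlib and the tree; axioms are the standard three.
-/

set_option linter.dupNamespace false -- D-0017: single-problem summit ⇒ `QuantumAdvantage.QuantumAdvantage` by design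

noncomputable section

namespace Summit.QuantumAdvantage.QuantumAdvantage.Theorems.CubicForrelation.NearExactIsExact

open Finset
open Literature.Computability.QuantumComplexity
open Literature.Computability.QuantumComplexity.DerivativeWalsh (W)

/-- **`Φ ≥ 127/128 ⇒ Φ = 1` for cubic pairs on `10 + 10` bits** (the assembly described in the header). [this work] -/
theorem tb20_isolation_twenty_ge (f g : (Fin (10 + 10) → Bool) → Bool) (hf : IsDegLeFun 3 f) (hg : IsDegLeFun 3 g)
    (hΦ : (127 / 128 : ℝ) ≤ forrelation f g) : forrelation f g = 1 := by
  obtain ⟨u, hu⟩ := tw_base g hg 7 (by norm_num)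
  by_cases hodd : ∃ x, Odd (u x)
  · -- type O (the level-7 parity is constant)
    obtain ⟨x₀, hx₀⟩ := hodd
    have hdeg := stub_walshTower stub_axParity (10 + 10) 7 0 g u hg hu (by intro k hk hkn; omega)
    have hall : ∀ x, Odd (u x) := by
      intro x
      have hc := tc_const_of_deg_zero hdeg x x₀
      rw [decide_eq_true hx₀] at hc
      exact of_decide_eq_true hc
    exact absurd hΦ (not_le.2 (tt20_typeO_lt f g hf hg u hu hall))
  · push Not at hodd
    have hu₈ := tw_level_up g u hu hodd
    exact tl20_levelEight_ge f g hf hg _ hu₈ hΦ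

/-- **The boundary value `127/128` is not attained on 20 bits: `Φ(f,g) ≥ 127/128 ⇒ Φ(f,g) = 1` for all cubic `f, g : 𝔽₂²⁰ → 𝔽₂`** (at the
literal type `Fin 20`).  Improves `theta_twenty_bounds` (`>`) to `≥`; the improvement is two-sided (it uses the partner `f`).
Finite-slice verdict; NOT summit progress. [this work] -/
theorem isolation_twenty_closed : ∀ f g : (Fin 20 → Bool) → Bool, IsDegLeFun 3 f → IsDegLeFun 3 g →
    (127 / 128 : ℝ) ≤ forrelation f g → forrelation f g = 1 :=
  fun f g hf hg h => tb20_isolation_twenty_ge f g hf hg h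

/-- **`θ₂₀ < 127/128`: some constant strictly below `127/128` already isolates exactness for cubic pairs on 20 bits.**  Finite-slice verdict;
NOT summit progress. [this work] -/
theorem theta_twenty_lt : ∃ θ : ℝ, θ < 127 / 128 ∧ ∀ f g : (Fin 20 → Bool) → Bool, IsDegLeFun 3 f → IsDegLeFun 3 g →
    θ < forrelation f g → forrelation f g = 1 :=
  fb_theta_lt_of_closed (n := 20) (127 / 128) isolation_twenty_closed

/-- **`θ₂₀ ∈ [15/16, 127/128)`** — the `n = 20` row of the ladder with a HALF-OPEN upper end: the least isolation constant `θ₂₀` for cubic pairs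
on 20 bits exists, is at least `15/16` (`theta_twenty_bounds`) and is STRICTLY below the uniform one-sided constant `127/128` (`theta_twenty_lt`).
The window `(15/16, 127/128)` remains open.  Finite-slice verdict; NOT summit progress. [this work] -/
theorem theta_twenty_halfopen : ∃ θ₀ : ℝ, 15 / 16 ≤ θ₀ ∧ θ₀ < 127 / 128 ∧
    IsLeast {θ : ℝ | ∀ f g : (Fin 20 → Bool) → Bool, IsDegLeFun 3 f → IsDegLeFun 3 g →
      θ < forrelation f g → forrelation f g = 1} θ₀ := by
  obtain ⟨θ₀, hθ₀⟩ := theta_exists 20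
  obtain ⟨θ', hθ', hiso⟩ := theta_twenty_lt
  exact ⟨θ₀, theta_twenty_bounds.2 θ₀ hθ₀.1, lt_of_le_of_lt (hθ₀.2 hiso) hθ', hθ₀⟩

/-- **No cubic pair on 20 bits has `127/128 ≤ Φ < 1`** (the closed boundary window is empty). [this work] -/
theorem no_boundary_window_twenty : ¬ ∃ f g : (Fin 20 → Bool) → Bool, IsDegLeFun 3 f ∧ IsDegLeFun 3 g ∧
    (127 / 128 : ℝ) ≤ forrelation f g ∧ forrelation f g < 1 := by
  rintro ⟨f, g, hf, hg, hge, hlt⟩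
  exact absurd (isolation_twenty_closed f g hf hg hge) (ne_of_lt hlt)

end Summit.QuantumAdvantage.QuantumAdvantage.Theorems.CubicForrelation.NearExactIsExact

end
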